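import Summits.ValiantsHypothesis.ValiantsHypothesis.Theorems.FifoMatchingNNDivisionHardConePricingTwistedFaceZones

/-!
# TwistedFace44 (part 2/2: §4–§5) — the UNRESTRICTED corona zonotope is unbudgeted (val-idea-44 g1, W7 lane (b), T0 test of V#109)

PORT (val-port-3 g3; desk ruling #451) of `Cruxes/NNDivisionHard/TwistedFace44.lean` @6d4ae4b3db08 (sha16 a49b35627af9acdb; author val-idea-44 g1; critic
val-idea-crit-9 g3 V#119b), part 2 of 2: §4 the certificate (TWISTED TWIN FACE: `tw`, `rankOne_dot_coronaKernel`, `cRow`, `val0`, `cRow_dot_zone`, `uPart_abs_le`,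
`one_le_abs_val0`, `cRow_sign`, `val0_selected`, `cRow_dot_selected`) and §5 ★★★ `mirror_three_pow_le` (`3ⁿ ≤ (r+1)·2ⁿ` for every EF of size `r` of a corona
zonotope containing the `2ⁿ` mirror pairs), `zCorAll_three_pow_le`, `zCorAll_not_hasEF`, `balanced_three_pow_le'`.  `variable {h : ℕ}` re-opened; namespace
`…Theorems.FifoMatching.ConePricing.TwistedFace` as in part 1; docstrings added where `lint.docstring` requires; no statement / proof / name edited; the author's
full module docstring (certificate, mechanism, numerical check) is reproduced in `FifoMatchingNNDivisionHardConePricingTwistedFaceZones.lean`.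
`--supports stmt-ValiantsHypothesis-21181` helper.  ALL CREDIT: val-idea-44 g1.  HONEST LABEL: lane-(b) NEGATIVE design test; closes NO route item;
`NNDivisionHard` (21181) OPEN; VP ≠ VNP is NOT proved here or anywhere in this tree.
-/

set_option autoImplicit false
-- the mandated summit-side namespace repeats a component by design (single-problem summit)
set_option linter.dupNamespace false

noncomputable section
open Finset

namespace Summit.ValiantsHypothesis.ValiantsHypothesis.Theorems.FifoMatching.ConePricing.TwistedFace

open Literature.Barriers.PneNP (HasEFOfSize)
open Literature.Combinatorics.Optimization (corPolytopeGraph corVec)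
open Summit.ValiantsHypothesis.ValiantsHypothesis.Theorems.FifoMatching.ConePricing

variable {h : ℕ}

/-! ## 4. The certificate -/

/-- the twin weight as a real vector. -/
def tw (n h : ℕ) (p : Fin h) : ℝ := (twZ n h p : ℝ)

/-- `Σ_S tw = ↑(Σ_S twZ)`. -/
theorem sum_tw (n h : ℕ) (S : Finset (Fin h)) : ∑ p ∈ S, tw n h p = ((∑ p ∈ S, twZ n h p : ℤ) : ℝ) := by
  unfold tw; push_cast; rfl

/-- a positive rank-one functional on a corona kernel: `(Σ_{A∪B} w)² − (Σ_B w)²`. -/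
theorem rankOne_dot_coronaKernel (w : Fin h → ℝ) (A B : Finset (Fin h)) :
    (fun x : Fin h × Fin h => w x.1 * w x.2) ⬝ᵥ coronaKernel A B = (∑ p ∈ A ∪ B, w p) ^ 2 - (∑ p ∈ B, w p) ^ 2 := by
  have : (fun x : Fin h × Fin h => w x.1 * w x.2) = -(fun x : Fin h × Fin h => -(w x.1 * w x.2)) := by
    ext x; simp
  rw [this, neg_dotProduct, negRankOne_dot_coronaKernel]
  ring

/-- the row functional `c_a = −u_a u_aᵀ + λ·v vᵀ`. -/
def cRow (n h : ℕ) (hm : n + 1 ≤ h) (lam : ℝ) (a : Finset (Fin n)) : Fin h × Fin h → ℝ :=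
  (fun x : Fin h × Fin h => -(uPush (rhoR n h hm) a x.1 * uPush (rhoR n h hm) a x.2))
    + lam • (fun x : Fin h × Fin h => tw n h x.1 * tw n h x.2)

/-- the `a`-independent part `V_A (V_A + 2 V_B)` of the value of `c_a` on the zone `(A,B)`. -/
def val0 (n h : ℕ) (A B : Finset (Fin h)) : ℝ := (∑ p ∈ A, tw n h p) * ((∑ p ∈ A, tw n h p) + 2 * ∑ p ∈ B, tw n h p)

/-- value of `c_a` on a zone: `−U_A(U_A + 2U_B) + λ·V_A(V_A + 2V_B)`. -/
theorem cRow_dot_zone (n h : ℕ) (hm : n + 1 ≤ h) (lam : ℝ) (a : Finset (Fin n)) (A B : Finset (Fin h)) (hAB : Disjoint A B) :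
    cRow n h hm lam a ⬝ᵥ coronaKernel A B
      = -((∑ p ∈ A, uPush (rhoR n h hm) a p) * ((∑ p ∈ A, uPush (rhoR n h hm) a p) + 2 * ∑ p ∈ B, uPush (rhoR n h hm) a p))
        + lam * val0 n h A B := by
  rw [cRow, add_dotProduct, smul_dotProduct, smul_eq_mul, negRankOne_dot_coronaKernel, rankOne_dot_coronaKernel,
    Finset.sum_union hAB, Finset.sum_union hAB, val0]
  ring

/-- the `u`-part is bounded: `|U_A(U_A + 2U_B)| ≤ 2(h(n+1))²` … stated as the two inequalities we use. -/
theorem uPart_abs_le (n h : ℕ) (hm : n + 1 ≤ h) (a : Finset (Fin n)) (A B : Finset (Fin h)) (hAB : Disjoint A B) :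
    |(∑ p ∈ A, uPush (rhoR n h hm) a p) * ((∑ p ∈ A, uPush (rhoR n h hm) a p) + 2 * ∑ p ∈ B, uPush (rhoR n h hm) a p)|
      ≤ 2 * ((h : ℝ) * ((n : ℝ) + 1)) ^ 2 := by
  have h1 := abs_sumU_le (rhoR n h hm) a (A ∪ B)
  have h2 := abs_sumU_le (rhoR n h hm) a B
  rw [Finset.sum_union hAB] at h1
  set UA := ∑ p ∈ A, uPush (rhoR n h hm) a p
  set UB := ∑ p ∈ B, uPush (rhoR n h hm) a p
  set M := (h : ℝ) * ((n : ℝ) + 1)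
  have hM : 0 ≤ M := by positivity
  have e : UA * (UA + 2 * UB) = (UA + UB) ^ 2 - UB ^ 2 := by ring
  rw [e]
  have hsq1 : (UA + UB) ^ 2 ≤ M ^ 2 := by
    rw [← sq_abs (UA + UB)]; exact pow_le_pow_left₀ (abs_nonneg _) h1 2
  have hsq2 : UB ^ 2 ≤ M ^ 2 := by
    rw [← sq_abs UB]; exact pow_le_pow_left₀ (abs_nonneg _) h2 2
  rw [abs_le]
  constructor <;> nlinarith [sq_nonneg (UA + UB), sq_nonneg UB]

/-- `val0` is an integer; if it is nonzero its absolute value is at least `1`. -/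
theorem one_le_abs_val0 (n h : ℕ) (A B : Finset (Fin h)) (hne : val0 n h A B ≠ 0) : 1 ≤ |val0 n h A B| := by
  have hz : val0 n h A B = (((∑ p ∈ A, twZ n h p) * ((∑ p ∈ A, twZ n h p) + 2 * ∑ p ∈ B, twZ n h p) : ℤ) : ℝ) := by
    rw [val0, sum_tw, sum_tw]; push_cast; ring
  rw [hz] at hne ⊢
  have hk : ((∑ p ∈ A, twZ n h p) * ((∑ p ∈ A, twZ n h p) + 2 * ∑ p ∈ B, twZ n h p) : ℤ) ≠ 0 := by
    intro h0; apply hne; rw [h0]; simp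
  rw [← Int.cast_abs]
  exact_mod_cast Int.one_le_abs hk

/-- ★ SIGN COHERENCE.  With `λ = 2(h(n+1))² + 1`: on a zone with `val0 > 0` the row value is positive, with `val0 < 0` negative,
and with `val0 = 0` nonpositive — for EVERY row `a`. -/
theorem cRow_sign (n h : ℕ) (hh : 2 * n + 2 ≤ h) (lam : ℝ) (hlam : 2 * ((h : ℝ) * ((n : ℝ) + 1)) ^ 2 + 1 ≤ lam)
    (a : Finset (Fin n)) (A B : Finset (Fin h)) (hAB : Disjoint A B) :
    (0 < val0 n h A B → 0 < cRow n h (by omega) lam a ⬝ᵥ coronaKernel A B) ∧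
    (val0 n h A B < 0 → cRow n h (by omega) lam a ⬝ᵥ coronaKernel A B < 0) ∧
    (val0 n h A B = 0 → cRow n h (by omega) lam a ⬝ᵥ coronaKernel A B ≤ 0) := by
  have hm : n + 1 ≤ h := by omega
  have hval := cRow_dot_zone n h hm lam a A B hAB
  have hu := uPart_abs_le n h hm a A B hAB
  set UA := ∑ p ∈ A, uPush (rhoR n h hm) a p with hUA
  set UB := ∑ p ∈ B, uPush (rhoR n h hm) a p with hUB
  set M2 := ((h : ℝ) * ((n : ℝ) + 1)) ^ 2 with hM2
  have hM2 : 0 ≤ M2 := by positivity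
  rw [abs_le] at hu
  refine ⟨fun hpos => ?_, fun hneg => ?_, fun hzero => ?_⟩
  · have h1 := one_le_abs_val0 n h A B hpos.ne'
    rw [abs_of_pos hpos] at h1
    rw [hval]
    nlinarith
  · have h1 := one_le_abs_val0 n h A B hneg.ne
    rw [abs_of_neg hneg] at h1
    rw [hval]
    nlinarith
  · rw [hval, hzero, mul_zero, add_zero]
    -- `val0 = 0`: either `A = ∅` (value `0`) or `B` avoids the block (`U_B = 0`, value `−U_A²`)
    have hz : (∑ p ∈ A, twZ n h p) * ((∑ p ∈ A, twZ n h p) + 2 * ∑ p ∈ B, twZ n h p) = 0 := by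
      have : (((∑ p ∈ A, twZ n h p) * ((∑ p ∈ A, twZ n h p) + 2 * ∑ p ∈ B, twZ n h p) : ℤ) : ℝ) = 0 := by
        rw [← hzero, val0, sum_tw, sum_tw]; push_cast; ring
      exact_mod_cast this
    rcases zone_zero_cases n h hh A B hz with hA | hB
    · have : UA = 0 := by rw [hUA, hA]; simp
      rw [this]; simp
    · have : UB = 0 := by rw [hUB]; exact sumU_offblock n h hm a B hB
      rw [this]
      nlinarith [sq_nonneg UA]

/-- the selected (mirror) zone of the pattern `b`: `val0 = 0` there. -/
theorem val0_selected (n h : ℕ) (hh : 2 * n + 2 ≤ h) (b : Finset (Fin n)) :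
    val0 n h ((rootSet b).map (rhoR n h (by omega))) ((rootSet b).map (rhoR' n h hh)) = 0 := by
  have hm : n + 1 ≤ h := by omega
  rw [val0]
  have hsum : (∑ p ∈ (rootSet b).map (rhoR n h hm), tw n h p) + 2 * ∑ p ∈ (rootSet b).map (rhoR' n h hh), tw n h p = 0 := by
    rw [Finset.sum_map, Finset.sum_map, Finset.mul_sum, ← Finset.sum_add_distrib]
    refine Finset.sum_eq_zero fun i _ => ?_
    simp only [tw]
    rw [twZ_rhoR n h hm i, twZ_rhoR' n h hh i]
    push_cast
    ring
  rw [hsum, mul_zero]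

/-- the row value on the selected zone of `b`: `−(|a ∩ b| − 1)²`. -/
theorem cRow_dot_selected (n h : ℕ) (hh : 2 * n + 2 ≤ h) (lam : ℝ) (a b : Finset (Fin n)) :
    cRow n h (by omega) lam a ⬝ᵥ coronaKernel ((rootSet b).map (rhoR n h (by omega))) ((rootSet b).map (rhoR' n h hh))
      = -((((a ∩ b).card : ℝ) - 1) ^ 2) := by
  classical
  have hm : n + 1 ≤ h := by omega
  have hAB : Disjoint ((rootSet b).map (rhoR n h hm)) ((rootSet b).map (rhoR' n h hh)) := by
    rw [Finset.disjoint_left]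
    intro p hpA hpB
    obtain ⟨i, -, rfl⟩ := Finset.mem_map.mp hpA
    obtain ⟨j, -, hj⟩ := Finset.mem_map.mp hpB
    have := congrArg Fin.val hj
    simp only [rhoR'_val, rhoR_val] at this
    have := i.isLt
    omega
  rw [cRow_dot_zone n h hm lam a _ _ hAB, val0_selected n h hh b, mul_zero, add_zero]
  have hB0 : ∑ p ∈ (rootSet b).map (rhoR' n h hh), uPush (rhoR n h hm) a p = 0 := by
    refine sumU_offblock n h hm a _ fun p hp => ?_
    obtain ⟨i, -, rfl⟩ := Finset.mem_map.mp hp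
    simp only [rhoR'_val]; omega
  have hA : ∑ p ∈ (rootSet b).map (rhoR n h hm), uPush (rhoR n h hm) a p = ((a ∩ b).card : ℝ) - 1 := by
    rw [Finset.sum_map]
    have : ∀ i ∈ rootSet b, uPush (rhoR n h hm) a ((rhoR n h hm) i) = uVec a i := fun i _ => uPush_rhoR_at n h hm a i
    rw [Finset.sum_congr rfl this, rootSet, Finset.sum_filter, ← sum_uVec_chi a b]
    refine Finset.sum_congr rfl fun i _ => ?_
    simp only [chi]
    split_ifs <;> simp
  rw [hB0, hA]
  ring

/-! ## 5. The theorem -/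

/-- ★★★ MIRROR-SHATTERED CORONA ZONOTOPES ARE UNBUDGETED.  Any corona zonotope `Σ_{(A,B) ∈ F} [0,1]·g_{A,B}` on disjoint pairs whose zone family
CONTAINS the `2ⁿ` mirror pairs `(ρ(rootSet b), ρ′(rootSet b))` obeys `3ⁿ ≤ (xc + 1)·2ⁿ` — no size-matching, no condition on the other zones. -/
theorem mirror_three_pow_le (n h r : ℕ) (hh : 2 * n + 2 ≤ h) (F : Finset (Fin h) → Finset (Fin h) → Prop)
    (hF : ∀ A B, F A B → Disjoint A B)
    (hsel : ∀ b : Finset (Fin n), F ((rootSet b).map (rhoR n h (by omega))) ((rootSet b).map (rhoR' n h hh)))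
    (hEF : HasEFOfSize (zCorFam h F) r) : 3 ^ n ≤ (r + 1) * 2 ^ n := by
  classical
  have hm : n + 1 ≤ h := by omega
  set lam : ℝ := 2 * ((h : ℝ) * ((n : ℝ) + 1)) ^ 2 + 1 with hlam
  -- base point: all zones of `F` with positive twisted value
  set ind : Finset (Fin h) × Finset (Fin h) → ℝ := fun AB => if F AB.1 AB.2 ∧ 0 < val0 n h AB.1 AB.2 then 1 else 0 with hind
  set vbase : Fin h × Fin h → ℝ := ∑ AB : Finset (Fin h) × Finset (Fin h), ind AB • coronaKernel AB.1 AB.2 with hvbase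
  set sel : Finset (Fin n) → Finset (Fin h) × Finset (Fin h) :=
    fun b => ((rootSet b).map (rhoR n h hm), (rootSet b).map (rhoR' n h hh)) with hsel_def
  have hsel0 : ∀ b, ¬ (0 < val0 n h (sel b).1 (sel b).2) := fun b => by
    rw [hsel_def]; dsimp only; rw [val0_selected n h hh b]; exact lt_irrefl 0
  -- the row values dotted into the base point
  have hdot_base : ∀ a, cRow n h hm lam a ⬝ᵥ vbase = ∑ AB : Finset (Fin h) × Finset (Fin h), ind AB * (cRow n h hm lam a ⬝ᵥ coronaKernel AB.1 AB.2) := by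
    intro a
    rw [hvbase, dotProduct_sum]
    exact Finset.sum_congr rfl fun AB _ => by rw [dotProduct_smul, smul_eq_mul]
  refine hEF.three_pow_le (fun b => vbase + coronaKernel (sel b).1 (sel b).2) (fun b => ?_) (fun a => cRow n h hm lam a)
    (fun a => cRow n h hm lam a ⬝ᵥ vbase) ?_ ?_ ?_
  · -- membership: indicator of the positive zones of `F` plus the selected zone (which is not positive)
    refine ⟨fun AB => ind AB + (if AB = sel b then 1 else 0), fun AB => ?_, fun AB hAB => ?_, ?_⟩
    · rw [hind]; dsimp only
      by_cases hpos : F AB.1 AB.2 ∧ 0 < val0 n h AB.1 AB.2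
      · rw [if_pos hpos, if_neg]
        · norm_num
        · rintro rfl; exact hsel0 b hpos.2
      · rw [if_neg hpos]; split_ifs <;> norm_num
    · rw [hind]; dsimp only
      rw [if_neg (fun hc => hAB hc.1), if_neg]
      · norm_num
      · rintro rfl; exact hAB (by rw [hsel_def]; exact hsel b)
    · rw [hvbase]
      simp only [add_smul, Finset.sum_add_distrib, ite_smul, one_smul, zero_smul, Finset.sum_ite_eq', Finset.mem_univ, if_true]
  · -- validity: termwise sign coherence
    rintro a x ⟨μ, hμ, hμ0, rfl⟩
    rw [dotProduct_sum, hdot_base a]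
    refine Finset.sum_le_sum fun AB _ => ?_
    rw [dotProduct_smul, smul_eq_mul, hind]
    dsimp only
    by_cases hFAB : F AB.1 AB.2
    · have hs := cRow_sign n h hh lam le_rfl a AB.1 AB.2 (hF _ _ hFAB)
      rcases lt_trichotomy 0 (val0 n h AB.1 AB.2) with hpos | hzero | hneg
      · rw [if_pos ⟨hFAB, hpos⟩, one_mul]
        have := hs.1 hpos
        nlinarith [(hμ AB).1, (hμ AB).2]
      · have hnot : ¬ (F AB.1 AB.2 ∧ 0 < val0 n h AB.1 AB.2) := by
          rintro ⟨-, hc⟩; rw [← hzero] at hc; exact lt_irrefl _ hc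
        rw [if_neg hnot, zero_mul]
        exact mul_nonpos_of_nonneg_of_nonpos (hμ AB).1 (hs.2.2 hzero.symm)
      · rw [if_neg (fun hc => lt_asymm hneg hc.2), zero_mul]
        have := hs.2.1 hneg
        nlinarith [(hμ AB).1]
    · rw [hμ0 AB hFAB, zero_mul, if_neg (fun hc => hFAB hc.1), zero_mul]
  · -- slack pattern: `slack(a,b) = (|a ∩ b| − 1)²`, zero only if `|a ∩ b| = 1`
    intro a b hlt hcard
    rw [dotProduct_add, hsel_def] at hlt
    dsimp only at hlt
    rw [cRow_dot_selected n h hh lam a b, hcard] at hlt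
    norm_num at hlt
  · intro a b hab
    rw [dotProduct_add, hsel_def]
    dsimp only
    rw [cRow_dot_selected n h hh lam a b, Finset.disjoint_iff_inter_eq_empty.mp hab]
    norm_num

/-- ★★★ THE UNRESTRICTED CORONA ZONOTOPE `Z′_cor(h) = Σ_{A ≠ ∅, A ∩ B = ∅} [0,1]·g_{A,B}` (41's canonical covering zonotope, 44 g0's
«conjecture FAN-CHEAP») is UNBUDGETED: `3ⁿ ≤ (xc + 1)·2ⁿ` for `2n + 2 ≤ h`, i.e. `xc(Z′_cor(h)) ≥ 1.5^{⌊h/2⌋ − 1} − 1`. -/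
theorem zCorAll_three_pow_le (n h r : ℕ) (hh : 2 * n + 2 ≤ h)
    (hEF : HasEFOfSize (zCorFam h (fun A B => A.Nonempty ∧ Disjoint A B)) r) : 3 ^ n ≤ (r + 1) * 2 ^ n := by
  classical
  refine mirror_three_pow_le n h r hh _ (fun A B hAB => hAB.2) (fun b => ⟨?_, ?_⟩) hEF
  · exact ⟨rhoR n h (by omega) 0, Finset.mem_map_of_mem _ (zero_mem_rootSet b)⟩
  · rw [Finset.disjoint_left]
    intro p hpA hpB
    obtain ⟨i, -, rfl⟩ := Finset.mem_map.mp hpA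
    obtain ⟨j, -, hj⟩ := Finset.mem_map.mp hpB
    have := congrArg Fin.val hj
    simp only [rhoR'_val, rhoR_val] at this
    have := i.isLt
    omega

/-- `Z′_cor(2n+2)` has no extended formulation of size `R` once `(R+1)·2ⁿ < 3ⁿ`. -/
theorem zCorAll_not_hasEF (n R : ℕ) (hlt : (R + 1) * 2 ^ n < 3 ^ n) :
    ¬ HasEFOfSize (zCorFam (2 * n + 2) (fun A B => A.Nonempty ∧ Disjoint A B)) R := fun hEF =>
  absurd (zCorAll_three_pow_le n (2 * n + 2) R le_rfl hEF) (not_le.mpr hlt)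

/-- the size-matched theorem of 44 g0 (`zCorSM_three_pow_le`, hypothesis `2n+3 ≤ h`) re-derived from the mirror certificate — size matching was never needed. -/
theorem balanced_three_pow_le' (n h r : ℕ) (hh : 2 * n + 2 ≤ h)
    (hEF : HasEFOfSize (zCorFam h (fun A B => Disjoint A B ∧ A.card = B.card)) r) : 3 ^ n ≤ (r + 1) * 2 ^ n := by
  classical
  refine mirror_three_pow_le n h r hh _ (fun A B hAB => hAB.1) (fun b => ⟨?_, by rw [Finset.card_map, Finset.card_map]⟩) hEF
  rw [Finset.disjoint_left]
  intro p hpA hpB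
  obtain ⟨i, -, rfl⟩ := Finset.mem_map.mp hpA
  obtain ⟨j, -, hj⟩ := Finset.mem_map.mp hpB
  have := congrArg Fin.val hj
  simp only [rhoR'_val, rhoR_val] at this
  have := i.isLt
  omega

end Summit.ValiantsHypothesis.ValiantsHypothesis.Theorems.FifoMatching.ConePricing.TwistedFace
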